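import Summits.QuantumAdvantage.QuantumAdvantage.Theorems.LinnikCubicClassGroupsDegreeOnePrimesEscapeOneSidedFrobenius
import Summits.QuantumAdvantage.QuantumAdvantage.Theorems.LinnikCubicClassGroupsDegreeOnePrimesEscapeCyclicInertPrime
import HarnessLib

/-!
# The least prime that does not split completely in a Galois number field is `≤ |d_N|^L`

Topic `Summits/QuantumAdvantage/QuantumAdvantage/Theorems`, cell B2b-1 (linnik-cubic), PART A (gen 8);
helper toward the crux `DegreeOnePrimesEscape` (stmt-QuantumAdvantage-11543) of route
`LinnikCubicClassGroups`.  HONEST FRAMING: the value of this file is a THEOREM (kernel-checked, GRH-free,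
Siegel-free, no hypothesis) — NOT summit progress.

**Theorem** (`exists_nonsplitPrime_le`).  For every `n > 1` there is `L = L(n) > 0` such that every
Galois number field `N` of degree `n` has a prime `p ≤ |d_N|^L`, `p ∤ d_N`, above which NO prime of
`N` has residue degree one (`Frob_p ≠ 1`; in particular `p` does not split completely in `N`).

This is the simplest instance of the one-sided principle `exists_frobenius_mem_of_oneSided`
(`…OneSidedFrobenius.lean`): `n·𝟙[x ≠ 1] = n − Ind_1^G 1(x)` (the regular character), so only the
UPPER bound `θ_N(x) ≤ (1+η)x` for `N` itself and the prime number theorem for `ℚ` are used.  Known in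
print with explicit exponents by other elementary means (X. Li 2012; A. Zaman 2017,
`α = 1/(4(1−2|G|^{-2/3})(|G|−1))`; cf. Cho–Lemke Oliver–Zaman arXiv:2512.24963 §2.1); new here is only
the kernel-checked statement with an inexplicit exponent.

References: J. C. Lagarias, H. L. Montgomery, A. M. Odlyzko, Invent. Math. 54 (1979)
[LagariasMontgomeryOdlyzko1979]; R. Perlis, J. Number Theory 9 (1977) [Perlis1977].
-/

noncomputable section

open scoped NumberField nonZeroDivisors
open Finset Real Ideal NumberField
open Literature.NumberTheory.NumberFields Literature.NumberTheory.LFunctions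
  Literature.NumberTheory.LFunctions.NumberField

namespace Summit.QuantumAdvantage.QuantumAdvantage.Theorems.DegreeOnePrimesEscape

/-- **The least prime with non-trivial Frobenius in a Galois number field, unconditionally**: for
`n > 1` there is `L > 0` such that every Galois number field `N` of degree `n` has a prime
`p ≤ |d_N|^{L}`, `p ∤ d_N`, with no degree-one prime of `N` above it (so `p` does not split completely).
[cite: LagariasMontgomeryOdlyzko1979, Theorem 1.1] -/
theorem exists_nonsplitPrime_le (n : ℕ) (hn : 1 < n) :
    ∃ L : ℝ, 0 < L ∧ ∀ (N : Type) [Field N] [NumberField N] [IsGalois ℚ N],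
      Module.finrank ℚ N = n →
        ∃ p : ℕ, p.Prime ∧ (p : ℝ) ≤ ((NumberField.discr N).natAbs : ℝ) ^ L ∧
          ¬ ((p : ℤ) ∣ NumberField.discr N) ∧ (splittingType N p).count 1 = 0 := by
  classical
  obtain ⟨L, hL, h⟩ := exists_frobenius_mem_of_oneSided n 1 n n hn hn
  refine ⟨L, hL, fun N _ _ _ hN => ?_⟩
  have hG : Nat.card (N ≃ₐ[ℚ] N) = n := by rw [IsGalois.card_aut_eq_finrank, hN]
  -- the one-sided data: `H₁ = 1`, `C = G ∖ {1}`, `n ≤ Ind_1(x) + n·𝟙[x ≠ 1]`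
  have hbot : ∀ i : Fin 1, (fun _ => (⊥ : Subgroup (N ≃ₐ[ℚ] N))) i ≠ ⊤ := by
    intro i hbt
    have hbt' : (⊥ : Subgroup (N ≃ₐ[ℚ] N)) = ⊤ := hbt
    have h1 : Nat.card (⊥ : Subgroup (N ≃ₐ[ℚ] N)) = Nat.card (⊤ : Subgroup (N ≃ₐ[ℚ] N)) := by
      rw [hbt']
    rw [Subgroup.card_bot, Subgroup.card_top, hG] at h1
    omega
  have hall : Nat.card {g : N ≃ₐ[ℚ] N // g * 1 * g⁻¹ ∈ (⊥ : Subgroup (N ≃ₐ[ℚ] N))} = n := by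
    rw [← hG]
    exact Nat.card_congr (Equiv.subtypeUnivEquiv fun g => by
      rw [mul_one, mul_inv_cancel]; exact Subgroup.one_mem _)
  obtain ⟨p, hp, hpx, hpN, Q, hQmax, hQover, φ, hφ, hI, hφC⟩ :=
    h N hN (fun _ => ⊥) {y : N ≃ₐ[ℚ] N | y ≠ 1} hbot (by
      intro x
      by_cases hx : x = 1
      · subst hx
        simp only [Finset.univ_unique, Finset.sum_singleton, hall, Subgroup.card_bot, Nat.cast_one,
          div_one]
        exact le_add_of_nonneg_right (by positivity)
      · rw [if_pos (show x ∈ {y : N ≃ₐ[ℚ] N | y ≠ 1} from hx)]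
        have : (0 : ℝ) ≤ ∑ i : Fin 1, (Nat.card {g : N ≃ₐ[ℚ] N // g * x * g⁻¹ ∈
            (fun _ => (⊥ : Subgroup (N ≃ₐ[ℚ] N))) i} : ℝ) /
              Nat.card ((fun _ => (⊥ : Subgroup (N ≃ₐ[ℚ] N))) i) := by positivity
        linarith)
  refine ⟨p, hp, hpx, hpN, ?_⟩
  -- `Frob_p ≠ 1` means no degree-one prime above `p`
  have hk := card_fixingSubgroup_mul_count_one_splittingType (⊤ : IntermediateField ℚ N) hp Q hφ hI
  rw [IntermediateField.fixingSubgroup_top, Subgroup.card_bot, one_mul, splittingType_top hp] at hk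
  rw [hk, Nat.card_eq_zero]
  left
  refine ⟨fun g => hφC ?_⟩
  have hg := Subgroup.mem_bot.mp g.2
  have : φ = g.1⁻¹ * (g.1 * φ * g.1⁻¹) * g.1 := by group
  rw [this, hg, mul_one, inv_mul_cancel]

end Summit.QuantumAdvantage.QuantumAdvantage.Theorems.DegreeOnePrimesEscape

end
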